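import Summits.RiemannHypothesis.RiemannHypothesis.Theorems.GroundBartaEvenWinsBeyondArchDeflationWeightedRitz
import Summits.RiemannHypothesis.RiemannHypothesis.Theorems.GroundBartaEvenWinsBeyondArchDeflationLipschitzMajorant
import HarnessLib

/-!
# RiemannHypothesis / GroundBarta — rung 4 (`EvenWinsBeyondArch`, stmt-RiemannHypothesis-18807 / 18085):
# the weighted deflated Temple L-side with trial vectors supported INSIDE the window (`[-c', c'] ⊆ [-c, c]`)

Helper file (`--supports stmt-RiemannHypothesis-18085`), RH-free, no definitions, no named facts.  Prover A (g10 of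
unit `sr-gb-rung-a`), endpoint cell `(log 5)/2`.

`dt_sector_bound_of_ritz_w` (file …WeightedRitz) takes `C²` × indicator Ritz vectors `v_i = g_i·𝟙_{[-c,c]}` whose
support edge IS the window edge.  At the endpoint `c = (log 5)/2` the window is irrational, so the certificates' trial
vectors are cut at a rational `c' < c`:  `v_i = g_i·𝟙_{[-c',c']}` with `g_i ∈ C¹`, `g_i(c') = 0` (edge-vanishing; then
`g_i(-c') = σ g_i(c') = 0` by parity), while the window images `F_i`, the prime index, the killing constant and the
complement certificate all live at the window `c`.  The abstract core `dt_sector_bound_w` only needs the vectors in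
the sector form domain of the window (`L²`, zero off `[-c, c]` ⊇ `[-c', c']`, real, parity, finite archimedean energy —
`dt_indicator_mul_mem_formDomain` at `c'`) and the window-image representation, whose majorant hypothesis is supplied by
`dt_exists_majorant_of_lipschitz` (file …LipschitzMajorant: an edge-vanishing `C¹ × indicator` vector is bounded and
Lipschitz).

* `dt_sector_bound_of_ritz_w_inner` — parity `σ`, the master statement;
* `dt_weilEvenGroundEnergy_ge_of_ritz_w_inner`, `dt_weilOddGroundEnergy_ge_of_ritz_w_inner` — `λ ≤ ε_ev(c)`,
  `λ ≤ ε_od(c)`.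
-/

set_option linter.dupNamespace false

noncomputable section

open MeasureTheory Set Filter
open scoped Topology ENNReal NNReal ComplexConjugate BigOperators

namespace Summit.RiemannHypothesis.RiemannHypothesis.Theorems.EvenWinsBeyondArch

open Literature.NumberTheory.LFunctions
open Summit.RiemannHypothesis.RiemannHypothesis.Theorems.OddSector (weilDirichletEnergy₂ weilPoleForm₂)

/-- **The weighted deflated Temple bound from edge-vanishing `C¹` × indicator Ritz data supported inside the window,
parity `σ`.**  As `dt_sector_bound_of_ritz_w`, except that the trial vectors are `v_i = g_i·𝟙_{[-c',c']}` with
`0 < c' ≤ c`, `g_i ∈ C¹`, `g_i(c') = 0`, while the window images `F_i` (pole layer, primes of `weilPrimeIndex c`,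
archimedean layer, killing constant `M_c`), the certificate and the PSD datum are those of the window `c`.
Conclusion: `λ ∫|φ|² ≤ Re Q(φ)` for every smooth test `φ` supported in `[-c, c]` with `φ(-x) = σ φ(x)`.
[cite: WeinsteinStenger1972, Ch. 5 §9 eq. (2) (k = 1: Temple's formula)] -/
theorem dt_sector_bound_of_ritz_w_inner {c c' : ℝ} (hc' : 0 < c') (hcc : c' ≤ c) (σ : ℝ) {k : ℕ}
    (g : Fin k → ℝ → ℝ) (hg : ∀ i, ContDiff ℝ 1 (g i)) (hgp : ∀ i x, g i (-x) = σ * g i x)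
    (hg0 : ∀ i, g i c' = 0)
    (v F : Fin k → ℝ → ℂ) (hv : ∀ i x, v i x = (((Icc (-c') c').indicator (g i) x : ℝ) : ℂ))
    (hF : ∀ i y, F i y = (Icc (-c) c).indicator (fun y ↦
        2 * (∫ x, v i x * (Real.cosh (x / 2) : ℂ)) * (Real.cosh (y / 2) : ℂ) -
          2 * (∫ x, v i x * (Real.sinh (x / 2) : ℂ)) * (Real.sinh (y / 2) : ℂ) +
        (∑ n ∈ weilPrimeIndex c, (((ArithmeticFunction.vonMangoldt n : ℝ) / Real.sqrt n : ℝ) : ℂ) *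
          (2 * v i y - v i (y - Real.log n) - v i (y + Real.log n))) +
        ∫ t in Ioi 0, (weilArchDensity t : ℂ) * (2 * v i y - v i (y - t) - v i (y + t))) y -
      (weilMarkovConstant c : ℂ) * v i y)
    (W : Fin k → Fin k → ℝ) (μ : Fin k → ℝ) (lam : ℝ) (hμ : ∀ i, 0 ≤ μ i)
    {n w : ℝ → ℝ} (hnm : Measurable n) (hwm : Measurable w) {C : ℝ} (hnC : ∀ y, |n y| ≤ C) (hwC : ∀ y, |w y| ≤ C)
    (hn0 : ∀ y, 0 ≤ n y) (hw0 : ∀ y, 0 ≤ w y) (hwn : ∀ y, w y * n y = 1)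
    (hcert : ∀ φ : ℝ → ℂ, IsWeilTest φ → tsupport φ ⊆ Icc (-c) c → (∀ x, φ (-x) = (σ : ℂ) * φ x) →
      (∫ y, n y * ‖φ y‖ ^ 2) + lam * ∫ x, ‖φ x‖ ^ 2 ≤
        (weilQuadratic φ).re + ∑ i, μ i * ‖∫ x, φ x * conj (v i x)‖ ^ 2)
    (hPSD : ∀ α : Fin k → ℝ, 0 ≤ ∑ i, ∑ j, α i * α j *
      ((weilPoleForm₂ (v i) (v j) + weilDirichletEnergy₂ c (v i) (v j) -
          weilMarkovConstant c * ∫ x, (v i x * conj (v j x)).re) - lam * (∫ x, (v i x * conj (v j x)).re) -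
        ∫ y, w y * ((F i - ∑ l, W i l • v l) y * conj ((F j - ∑ l, W j l • v l) y)).re))
    {φ : ℝ → ℂ} (hφ : IsWeilTest φ) (hφs : tsupport φ ⊆ Icc (-c) c) (hφp : ∀ x, φ (-x) = (σ : ℂ) * φ x) :
    lam * ∫ x, ‖φ x‖ ^ 2 ≤ (weilQuadratic φ).re := by
  have hc : 0 < c := lt_of_lt_of_le hc' hcc
  have hsub : Icc (-c') c' ⊆ Icc (-c) c := Icc_subset_Icc (by linarith) hcc
  have hveq : ∀ i, v i = fun x ↦ (((Icc (-c') c').indicator (g i) x : ℝ) : ℂ) := fun i ↦ funext (hv i)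
  have hg0' : ∀ i, g i (-c') = 0 := fun i ↦ by rw [hgp i c', hg0 i, mul_zero]
  -- the trial vectors lie in the sector form domain of the window `c`
  have hvD : ∀ i, MemLp (v i) 2 ∧ (∀ x, x ∉ Icc (-c) c → v i x = 0) ∧ (∀ x, (v i x).im = 0) ∧
      (∀ x, v i (-x) = (σ : ℂ) * v i x) ∧
      IntegrableOn (fun t ↦ weilArchDensity t * weilIncrement (v i) t) (Ioi 0) := by
    intro i
    obtain ⟨h1, h2, h3, h4⟩ := dt_indicator_mul_mem_formDomain hc' (hg i)
    refine ⟨by rw [hveq i]; exact h1, fun x hx ↦ by rw [hv i x]; exact h2 x (fun h ↦ hx (hsub h)),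
      fun x ↦ by rw [hv i x]; exact h3 x, fun x ↦ ?_, by rw [hveq i]; exact h4⟩
    rw [hv i, hv i]
    have hsym : (-x ∈ Icc (-c') c') ↔ (x ∈ Icc (-c') c') := by
      simp only [mem_Icc]; constructor <;> rintro ⟨h₁, h₂⟩ <;> constructor <;> linarith
    by_cases hx : x ∈ Icc (-c') c'
    · rw [indicator_of_mem (hsym.2 hx), indicator_of_mem hx, hgp i x]; push_cast; ring
    · rw [indicator_of_notMem (fun h ↦ hx (hsym.1 h)), indicator_of_notMem hx]; simp
  -- the vectors are bounded and Lipschitz, hence the archimedean majorant at the window `c`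
  have hmaj : ∀ i, ∃ m : ℝ → ℝ, MemLp m 2 volume ∧
      (∀ y ∈ Ioo (-c) c,
        IntegrableOn (fun t ↦ weilArchDensity t * ‖2 * v i y - v i (y - t) - v i (y + t)‖) (Ioi 0)) ∧
      (∀ y ∈ Ioo (-c) c,
        ∫ t in Ioi 0, weilArchDensity t * ‖2 * v i y - v i (y - t) - v i (y + t)‖ ≤ m y) := by
    intro i
    obtain ⟨G₀, hG₀⟩ := isCompact_Icc.exists_bound_of_continuousOn
      ((hg i).continuous.continuousOn : ContinuousOn (g i) (Icc (-c') c'))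
    obtain ⟨L, hL⟩ := isCompact_Icc.exists_bound_of_continuousOn
      (((hg i).continuous_deriv le_rfl).continuousOn : ContinuousOn (deriv (g i)) (Icc (-c') c'))
    obtain ⟨hb, hl⟩ := dt_indicator_edgeVanishing_bounds hc' (hg i) (hg0 i) (hg0' i)
      (fun z hz ↦ by rw [← Real.norm_eq_abs]; exact hG₀ z hz)
      (fun z hz ↦ by rw [← Real.norm_eq_abs]; exact hL z hz) (hv i)
    exact dt_exists_majorant_of_lipschitz c (dt_indicator_measurable (hg i).continuous (hv i)) hb hl
  have hFm : ∀ i, MemLp (F i) 2 := by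
    intro i
    obtain ⟨m, hm, _, hHm⟩ := hmaj i
    exact dt_windowImage_memLp (hvD i).1 hm hHm (hF i)
  have hrepr : ∀ i (f : ℝ → ℂ), MemLp f 2 → (∀ x, x ∉ Icc (-c) c → f x = 0) → (∀ x, (f x).im = 0) →
      (∀ x, f (-x) = (σ : ℂ) * f x) →
      IntegrableOn (fun t ↦ weilArchDensity t * weilIncrement f t) (Ioi 0) →
      weilPoleForm₂ (v i) f + weilDirichletEnergy₂ c (v i) f -
          weilMarkovConstant c * ∫ x, (v i x * conj (f x)).re = ∫ x, (F i x * conj (f x)).re := by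
    intro i f hf hfs _ _ _
    obtain ⟨m, hm, hHi, hHm⟩ := hmaj i
    exact dt_windowImage_repr (hvD i).1 hm hHi hHm (hF i) hf hfs
  exact dt_sector_bound_w hc σ v F W μ lam hμ hnm hwm hnC hwC hn0 hw0 hwn hvD hFm hrepr hcert hPSD hφ hφs hφp

/-- **Weighted deflated Temple lower bound for `ε_ev(c)` from even edge-vanishing `C¹` × indicator Ritz data
supported in `[-c', c'] ⊆ [-c, c]`**: `λ ≤ weilEvenGroundEnergy c`.
[cite: WeinsteinStenger1972, Ch. 5 §9 eq. (2) (k = 1: Temple's formula)] -/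
theorem dt_weilEvenGroundEnergy_ge_of_ritz_w_inner {c c' : ℝ} (hc' : 0 < c') (hcc : c' ≤ c) {k : ℕ}
    (g : Fin k → ℝ → ℝ) (hg : ∀ i, ContDiff ℝ 1 (g i)) (hge : ∀ i x, g i (-x) = g i x)
    (hg0 : ∀ i, g i c' = 0)
    (v F : Fin k → ℝ → ℂ) (hv : ∀ i x, v i x = (((Icc (-c') c').indicator (g i) x : ℝ) : ℂ))
    (hF : ∀ i y, F i y = (Icc (-c) c).indicator (fun y ↦
        2 * (∫ x, v i x * (Real.cosh (x / 2) : ℂ)) * (Real.cosh (y / 2) : ℂ) -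
          2 * (∫ x, v i x * (Real.sinh (x / 2) : ℂ)) * (Real.sinh (y / 2) : ℂ) +
        (∑ n ∈ weilPrimeIndex c, (((ArithmeticFunction.vonMangoldt n : ℝ) / Real.sqrt n : ℝ) : ℂ) *
          (2 * v i y - v i (y - Real.log n) - v i (y + Real.log n))) +
        ∫ t in Ioi 0, (weilArchDensity t : ℂ) * (2 * v i y - v i (y - t) - v i (y + t))) y -
      (weilMarkovConstant c : ℂ) * v i y)
    (W : Fin k → Fin k → ℝ) (μ : Fin k → ℝ) (lam : ℝ) (hμ : ∀ i, 0 ≤ μ i)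
    {n w : ℝ → ℝ} (hnm : Measurable n) (hwm : Measurable w) {C : ℝ} (hnC : ∀ y, |n y| ≤ C) (hwC : ∀ y, |w y| ≤ C)
    (hn0 : ∀ y, 0 ≤ n y) (hw0 : ∀ y, 0 ≤ w y) (hwn : ∀ y, w y * n y = 1)
    (hcert : ∀ φ : ℝ → ℂ, IsWeilTest φ → tsupport φ ⊆ Icc (-c) c → (∀ x, φ (-x) = φ x) →
      (∫ y, n y * ‖φ y‖ ^ 2) + lam * ∫ x, ‖φ x‖ ^ 2 ≤
        (weilQuadratic φ).re + ∑ i, μ i * ‖∫ x, φ x * conj (v i x)‖ ^ 2)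
    (hPSD : ∀ α : Fin k → ℝ, 0 ≤ ∑ i, ∑ j, α i * α j *
      ((weilPoleForm₂ (v i) (v j) + weilDirichletEnergy₂ c (v i) (v j) -
          weilMarkovConstant c * ∫ x, (v i x * conj (v j x)).re) - lam * (∫ x, (v i x * conj (v j x)).re) -
        ∫ y, w y * ((F i - ∑ l, W i l • v l) y * conj ((F j - ∑ l, W j l • v l) y)).re)) :
    lam ≤ weilEvenGroundEnergy c := by
  have hc : 0 < c := lt_of_lt_of_le hc' hcc
  refine le_weilEvenGroundEnergy_of_forall hc fun φ hφ hφs hφe hφn ↦ ?_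
  have h := dt_sector_bound_of_ritz_w_inner hc' hcc 1 g hg (fun i x ↦ by rw [hge i x]; ring) hg0 v F hv hF W μ
    lam hμ hnm hwm hnC hwC hn0 hw0 hwn (fun φ hφ hφs hφp ↦ hcert φ hφ hφs (fun x ↦ by simpa using hφp x)) hPSD
    hφ hφs (fun x ↦ by simpa using hφe x)
  rwa [hφn, mul_one] at h

/-- **Weighted deflated Temple lower bound for `ε_od(c)` from odd edge-vanishing `C¹` × indicator Ritz data
supported in `[-c', c'] ⊆ [-c, c]`**: `λ ≤ weilOddGroundEnergy c`.
[cite: WeinsteinStenger1972, Ch. 5 §9 eq. (2) (k = 1: Temple's formula)] -/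
theorem dt_weilOddGroundEnergy_ge_of_ritz_w_inner {c c' : ℝ} (hc' : 0 < c') (hcc : c' ≤ c) {k : ℕ}
    (g : Fin k → ℝ → ℝ) (hg : ∀ i, ContDiff ℝ 1 (g i)) (hgo : ∀ i x, g i (-x) = -g i x)
    (hg0 : ∀ i, g i c' = 0)
    (v F : Fin k → ℝ → ℂ) (hv : ∀ i x, v i x = (((Icc (-c') c').indicator (g i) x : ℝ) : ℂ))
    (hF : ∀ i y, F i y = (Icc (-c) c).indicator (fun y ↦
        2 * (∫ x, v i x * (Real.cosh (x / 2) : ℂ)) * (Real.cosh (y / 2) : ℂ) -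
          2 * (∫ x, v i x * (Real.sinh (x / 2) : ℂ)) * (Real.sinh (y / 2) : ℂ) +
        (∑ n ∈ weilPrimeIndex c, (((ArithmeticFunction.vonMangoldt n : ℝ) / Real.sqrt n : ℝ) : ℂ) *
          (2 * v i y - v i (y - Real.log n) - v i (y + Real.log n))) +
        ∫ t in Ioi 0, (weilArchDensity t : ℂ) * (2 * v i y - v i (y - t) - v i (y + t))) y -
      (weilMarkovConstant c : ℂ) * v i y)
    (W : Fin k → Fin k → ℝ) (μ : Fin k → ℝ) (lam : ℝ) (hμ : ∀ i, 0 ≤ μ i)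
    {n w : ℝ → ℝ} (hnm : Measurable n) (hwm : Measurable w) {C : ℝ} (hnC : ∀ y, |n y| ≤ C) (hwC : ∀ y, |w y| ≤ C)
    (hn0 : ∀ y, 0 ≤ n y) (hw0 : ∀ y, 0 ≤ w y) (hwn : ∀ y, w y * n y = 1)
    (hcert : ∀ φ : ℝ → ℂ, IsWeilTest φ → tsupport φ ⊆ Icc (-c) c → (∀ x, φ (-x) = -φ x) →
      (∫ y, n y * ‖φ y‖ ^ 2) + lam * ∫ x, ‖φ x‖ ^ 2 ≤
        (weilQuadratic φ).re + ∑ i, μ i * ‖∫ x, φ x * conj (v i x)‖ ^ 2)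
    (hPSD : ∀ α : Fin k → ℝ, 0 ≤ ∑ i, ∑ j, α i * α j *
      ((weilPoleForm₂ (v i) (v j) + weilDirichletEnergy₂ c (v i) (v j) -
          weilMarkovConstant c * ∫ x, (v i x * conj (v j x)).re) - lam * (∫ x, (v i x * conj (v j x)).re) -
        ∫ y, w y * ((F i - ∑ l, W i l • v l) y * conj ((F j - ∑ l, W j l • v l) y)).re)) :
    lam ≤ weilOddGroundEnergy c := by
  have hc : 0 < c := lt_of_lt_of_le hc' hcc
  refine le_weilOddGroundEnergy_of_forall hc fun φ hφ hφs hφo hφn ↦ ?_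
  have h := dt_sector_bound_of_ritz_w_inner hc' hcc (-1) g hg (fun i x ↦ by rw [hgo i x]; ring) hg0 v F hv hF W μ
    lam hμ hnm hwm hnC hwC hn0 hw0 hwn (fun φ hφ hφs hφp ↦ hcert φ hφ hφs (fun x ↦ by simpa using hφp x)) hPSD
    hφ hφs (fun x ↦ by simpa using hφo x)
  rwa [hφn, mul_one] at h

end Summit.RiemannHypothesis.RiemannHypothesis.Theorems.EvenWinsBeyondArch

end
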